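import Mathlib
import HarnessLib
import Summits.HubbardSuperconductivity.HubbardSuperconductivity.Theorems.KLProgrammeKLRegimeTwoVolumeSectionalMoment
import Summits.HubbardSuperconductivity.HubbardSuperconductivity.Theorems.KLProgrammeKLRegimeEngineScaleZeroE4Bands
import Summits.HubbardSuperconductivity.HubbardSuperconductivity.Theorems.KLProgrammeKLRegimeFrameShellCount
import Summits.HubbardSuperconductivity.HubbardSuperconductivity.Theorems.KLProgrammeSalmhoferCutoffFourthDerivBound

/-!
# β′ two-volume pass at SCALE `0` (bare frame `K₀ = 0`, `Λ = klE0`, grid `N = 2(2M)`): the ε-free one-volume data `hsec` (fixed-time far spatial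
# sums) and `hs` (sup entry) of k3c5-p2's `abs_klLocalPart_flowFrame_zero_sub_le_of_gridData`, LITERALLY; cell gate-hubbard-kl, seat k3c4-p2 (g7)

§2′: the far-sum and sup-entry COROLLARIES of `…TwoVolumeSectionalMoment` at a general scale (`sum_far_norm_gridSub_pullback_sectional_le`,
`sum_far_norm_gridSub_hubbardCovAboveCT_sectional_le`, the slice twin `sum_tnorm_mul_norm_gridSub_hubbardCovSliceCT_sectional_le` for the scales
`n ≥ 1`, `norm_gridSub_hubbardCovAboveCT_apply_le_of_isGramBoundedR`).  §3: the instance of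
`sum_tnorm_mul_norm_gridSub_hubbardCovAboveCT_sectional_le` at scale `0` with the tree's cutoff numerals
`‖Dˡχ₂‖ ≤ 3960000` (`l ≤ 4`, `…SalmhoferCutoffFourthDerivBound`) and the bare band sizes `‖Dⁱ(e − μ)‖ ≤ 4ⁱ` (`…EngineScaleZeroE4Bands`):

* `sum_tnorm_mul_norm_scaleZero_sectional_le` — `Σ_y tnorm(x′−y)·‖G_L X′ (((t,y),σ),c)‖ ≤ E₁⁰` for `G_L = S_Lᵀ C⁰_{>e₀} S_L`, every `M`, `L`,
  `0 < β`, `μ`, with `E₁⁰ = 96·3960000·(2π·129·4 + 12π²·129²·16 + 144π³·129³·64)·32 ≤ 2^74` (`scaleZero_sectionalConst_le_two_pow`);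
* **`hsec_scaleZero`** — `Σ_{y : R < tnorm(x′−y)} ‖G_L X′ (((t,y),σ),c)‖ ≤ 2^74/(R+1)` (the `hsec` hypothesis with `Te := 2^74/(R+1)`);
* **`hs_scaleZero`** — `‖G_L X Y‖ ≤ 2(7+6047)` for an admissible bare frame, `klBetaMin ≤ β ≤ L` (`isGramBoundedR_scaleZero_of_frameOK_sharp`);
* `sectionalMoment_scaleZero_le_of_entry` / `sectionalMoment_scaleZero_le` — the `(1+tnorm)`-weighted sectional row (`…TwoVolumeDataKit`'s `e₁`
  currency) `≤ 2(7+6047) + 2·2^74`.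

Everything uniform in `M` (no `ε = β/N`), `L`, `β`, `μ ∈ ℝ`.  Proofs only; no definitions.  References: BGM 2006 §2.1, Lemma 2.2
[cite: BenfattoGiulianiMastropietro2006].
-/

noncomputable section

namespace Summit.HubbardSuperconductivity.HubbardSuperconductivity.Theorems.TwoVolumeDefect

set_option linter.dupNamespace false -- summit = problem name (single-conjunct summit), D-0017

open Finset Complex Literature.MathematicalPhysics.QuantumLattice Literature.Probability.LatticeModels
open Summit.HubbardSuperconductivity.HubbardSuperconductivity.Theorems.KLRegimeSplit
open Summit.HubbardSuperconductivity.HubbardSuperconductivity.Theorems.DispersionFlow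
open Summit.HubbardSuperconductivity.HubbardSuperconductivity.Theorems.SampledSymbolKernel
open scoped ComplexConjugate Nat

/-! ## §2′ The far-sum (`hsec`) and sup-entry (`hs`) shapes at a general scale -/

section General

variable {L M N : ℕ} [NeZero L] [NeZero N]

/-- **Far fixed-time spatial sums from the sectional first moment**: under the hypotheses of
`sum_tnorm_mul_norm_gridSub_pullback_sectional_le`, `Σ_{y : R < tnorm(x′−y)} ‖G X′ (((t,y),σ),c)‖ ≤ (|β|⁻¹·Σ_i W i)/(R+1)`. -/
theorem sum_far_norm_gridSub_pullback_sectional_le (hN : 2 * M ≤ N) {β : ℝ} (hβ : β ≠ 0)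
    (p : FreqMomentum L M × Fin 2 → ℂ) (u : Fin 2 → MatsubaraIdx M → TorusSite 2 L → ℂ)
    (hp : ∀ (i : MatsubaraIdx M) (kv : TorusSite 2 L) (σ : Fin 2), p ((i, kv), σ) = ((β * (L : ℝ) ^ 2 : ℝ) : ℂ) * u σ i kv)
    {W : MatsubaraIdx M → ℝ}
    (hW : ∀ (σ : Fin 2) (i : MatsubaraIdx M), ∑ z : TorusSite 2 L, (Torus.tnorm z : ℝ) * ‖torusFourierInv (u σ i) z‖ ≤ W i)
    (R : ℕ) (X' : GridLeg (GridPoint L N)) (t : Fin N) (σ c : Fin 2) :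
    ∑ y ∈ univ.filter (fun y : TorusSite 2 L => R < Torus.tnorm (X'.1.1.2 - y)),
        ‖((hubbardGridSub L M β N).transpose * normalCovariance L M p * hubbardGridSub L M β N) X' (((t, y), σ), c)‖ ≤
      |β|⁻¹ * (∑ i : MatsubaraIdx M, W i) / ((R : ℝ) + 1) := by
  have h := sum_filter_le_div_of_weight univ
    (fun y : TorusSite 2 L => ‖((hubbardGridSub L M β N).transpose * normalCovariance L M p * hubbardGridSub L M β N) X' (((t, y), σ), c)‖)
    (fun y : TorusSite 2 L => Torus.tnorm (X'.1.1.2 - y)) (fun _ _ => norm_nonneg _) R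
  refine h.trans ?_
  rw [div_eq_inv_mul]
  exact mul_le_mul_of_nonneg_left (sum_tnorm_mul_norm_gridSub_pullback_sectional_le hN hβ p u hp hW X' t σ c) (by positivity)

/-- **The far fixed-time spatial sums** (the `hsec` datum of `hubbardGrid_sum_norm_kernel_sub_le_response`):
`Σ_{y : R < tnorm(x′−y)} ‖G X′ (((t,y),σ),c)‖ ≤ 96B(2π(1+4/Λ)D + 12π²(1+4/Λ)²D² + 144π³(1+4/Λ)³D³)/Λ/(R+1)`. -/
theorem sum_far_norm_gridSub_hubbardCovAboveCT_sectional_le (hN : 2 * M ≤ N) {β : ℝ} (hβ : 0 < β) {Λ : ℝ} (hΛ : 0 < Λ)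
    {B : ℝ} (hB1 : 1 ≤ B) (hB : ∀ i ≤ 3, ∀ t, ‖iteratedDeriv i salmhoferCutoff t‖ ≤ B) {μ : ℝ} {K : TrigPolyC4v} {D : ℝ}
    (hD0 : 0 ≤ D) (hD : ∀ i, 1 ≤ i → i ≤ 3 → ∀ p : Momentum, ‖iteratedFDeriv ℝ i (frameLevel μ K) p‖ ≤ D ^ i)
    (R : ℕ) (X' : GridLeg (GridPoint L N)) (t : Fin N) (σ c : Fin 2) :
    ∑ y ∈ univ.filter (fun y : TorusSite 2 L => R < Torus.tnorm (X'.1.1.2 - y)),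
        ‖((hubbardGridSub L M β N).transpose * hubbardCovAboveCT L M β μ 0 K Λ * hubbardGridSub L M β N) X' (((t, y), σ), c)‖ ≤
      96 * B * (2 * Real.pi * (1 + 4 / Λ) * D + 12 * Real.pi ^ 2 * (1 + 4 / Λ) ^ 2 * D ^ 2 + 144 * Real.pi ^ 3 * (1 + 4 / Λ) ^ 3 * D ^ 3) / Λ /
        ((R : ℝ) + 1) := by
  have h := sum_filter_le_div_of_weight univ
    (fun y : TorusSite 2 L => ‖((hubbardGridSub L M β N).transpose * hubbardCovAboveCT L M β μ 0 K Λ * hubbardGridSub L M β N) X' (((t, y), σ), c)‖)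
    (fun y : TorusSite 2 L => Torus.tnorm (X'.1.1.2 - y)) (fun _ _ => norm_nonneg _) R
  refine h.trans ?_
  rw [div_eq_inv_mul _ ((R : ℝ) + 1)]
  exact mul_le_mul_of_nonneg_left
    (sum_tnorm_mul_norm_gridSub_hubbardCovAboveCT_sectional_le hN hβ hΛ hB1 hB hD0 hD X' t σ c) (by positivity)

/-- **The sectional first moment of a pulled-back SLICE covariance** `S_Lᵀ·C^K_{(Λ,Λ′]}·S_L` (seed `0`; the one-volume datum of the
two-volume step at the scales `n ≥ 1`): at most the sum of the two ultraviolet bounds. -/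
theorem sum_tnorm_mul_norm_gridSub_hubbardCovSliceCT_sectional_le (hN : 2 * M ≤ N) {β : ℝ} (hβ : 0 < β) {Λ Λ' : ℝ} (hΛ : 0 < Λ)
    (hΛ' : 0 < Λ') {B : ℝ} (hB1 : 1 ≤ B) (hB : ∀ i ≤ 3, ∀ t, ‖iteratedDeriv i salmhoferCutoff t‖ ≤ B) {μ : ℝ} {K : TrigPolyC4v} {D : ℝ}
    (hD0 : 0 ≤ D) (hD : ∀ i, 1 ≤ i → i ≤ 3 → ∀ p : Momentum, ‖iteratedFDeriv ℝ i (frameLevel μ K) p‖ ≤ D ^ i)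
    (X' : GridLeg (GridPoint L N)) (t : Fin N) (σ c : Fin 2) :
    ∑ y : TorusSite 2 L, (Torus.tnorm (X'.1.1.2 - y) : ℝ) *
        ‖((hubbardGridSub L M β N).transpose * hubbardCovSliceCT L M β μ 0 K Λ Λ' * hubbardGridSub L M β N) X' (((t, y), σ), c)‖ ≤
      96 * B * (2 * Real.pi * (1 + 4 / Λ) * D + 12 * Real.pi ^ 2 * (1 + 4 / Λ) ^ 2 * D ^ 2 + 144 * Real.pi ^ 3 * (1 + 4 / Λ) ^ 3 * D ^ 3) / Λ +
      96 * B * (2 * Real.pi * (1 + 4 / Λ') * D + 12 * Real.pi ^ 2 * (1 + 4 / Λ') ^ 2 * D ^ 2 + 144 * Real.pi ^ 3 * (1 + 4 / Λ') ^ 3 * D ^ 3) / Λ' := by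
  have hsplit : (hubbardGridSub L M β N).transpose * hubbardCovSliceCT L M β μ 0 K Λ Λ' * hubbardGridSub L M β N =
      (hubbardGridSub L M β N).transpose * hubbardCovAboveCT L M β μ 0 K Λ * hubbardGridSub L M β N -
        (hubbardGridSub L M β N).transpose * hubbardCovAboveCT L M β μ 0 K Λ' * hubbardGridSub L M β N := by
    rw [hubbardCovSliceCT, Matrix.mul_sub, Matrix.sub_mul]
  rw [hsplit]
  have h1 := sum_tnorm_mul_norm_gridSub_hubbardCovAboveCT_sectional_le (μ := μ) (K := K) hN hβ hΛ hB1 hB hD0 hD X' t σ c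
  have h2 := sum_tnorm_mul_norm_gridSub_hubbardCovAboveCT_sectional_le (μ := μ) (K := K) hN hβ hΛ' hB1 hB hD0 hD X' t σ c
  refine le_trans (sum_le_sum fun y _ => ?_) (le_trans (le_of_eq (sum_add_distrib)) (add_le_add h1 h2))
  rw [Matrix.sub_apply, ← mul_add]
  exact mul_le_mul_of_nonneg_left (norm_sub_le _ _) (Nat.cast_nonneg _)

omit [NeZero N] in
/-- **The sup entry of `G = S_LᵀC^K_{>Λ}S_L` from replica-Gram-boundedness** (antisymmetry): `IsGramBoundedR G κ ⟹ ‖G X Y‖ ≤ κ²`. -/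
theorem norm_gridSub_hubbardCovAboveCT_apply_le_of_isGramBoundedR {β : ℝ} (μ : ℝ) (K : TrigPolyC4v) (Λ : ℝ) {κ : ℝ}
    (hGB : IsGramBoundedR ((hubbardGridSub L M β N).transpose * hubbardCovAboveCT L M β μ 0 K Λ * hubbardGridSub L M β N) κ)
    (X Y : GridLeg (GridPoint L N)) :
    ‖((hubbardGridSub L M β N).transpose * hubbardCovAboveCT L M β μ 0 K Λ * hubbardGridSub L M β N) X Y‖ ≤ κ ^ 2 := by
  rw [hubbardCovAboveCT_zero_seed_eq_normalCovariance_uvSymbolCT] at hGB ⊢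
  exact norm_gridSub_pullback_apply_le_of_isGramBoundedR _ hGB X Y

end General

/-! ## §3 Scale `0`, bare frame `K₀ = 0`, `Λ = klE0`, grid `N = 2(2M)`: the `hsec` and `hs` data of FILE C -/

section ScaleZero

variable {L M : ℕ} [NeZero L] [NeZero M]

omit [NeZero M] in
/-- `tnorm u = 0 ⟹ u = 0` on the torus (the centred representative vanishes). -/
theorem eq_zero_of_tnorm_eq_zero {d : ℕ} {u : TorusSite d L} (h : Torus.tnorm u = 0) : u = 0 := by
  have hc : Torus.cRep u = 0 := by
    funext i
    have hi := Site.natAbs_le_supNorm (Torus.cRep u) i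
    rw [Torus.tnorm] at h
    rw [h, Nat.le_zero, Int.natAbs_eq_zero] at hi
    exact hi
  rw [← Torus.proj_cRep u, hc]
  funext i
  rw [Torus.proj_apply]
  simp

/-- The cutoff numerals to order `3`, in `iteratedDeriv` currency: `‖χ₂⁽ⁱ⁾‖ ≤ 3960000` (`i ≤ 3`). -/
theorem norm_iteratedDeriv_salmhoferCutoff_le_numeral : ∀ i ≤ 3, ∀ t : ℝ, ‖iteratedDeriv i salmhoferCutoff t‖ ≤ 3960000 := by
  intro i hi t
  rw [← norm_iteratedFDeriv_eq_norm_iteratedDeriv]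
  exact norm_iteratedFDeriv_salmhoferCutoff_le_of_le_four (by omega) t

/-- **THE SECTIONAL FIRST MOMENT OF THE SCALE-`0` GRID COVARIANCE AT THE BARE FRAME** `G_L = S_Lᵀ·C⁰_{>e₀}·S_L`, `N = 2(2M)`, `0 < β`:
`Σ_y tnorm(x′−y)·‖G_L X′ (((t,y),σ),c)‖ ≤ E₁⁰ := 96·3960000·(2π·129·4 + 12π²·129²·16 + 144π³·129³·64)·32`, for every `M`, `L`, `β`, `μ`. -/
theorem sum_tnorm_mul_norm_scaleZero_sectional_le {β : ℝ} (hβ : 0 < β) (μ : ℝ) (X' : GridLeg (GridPoint L (2 * (2 * M))))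
    (t : Fin (2 * (2 * M))) (σ c : Fin 2) :
    ∑ y : TorusSite 2 L, (Torus.tnorm (X'.1.1.2 - y) : ℝ) *
        ‖((hubbardGridSub L M β (2 * (2 * M))).transpose * hubbardCovAboveCT L M β μ 0 0 klE0 *
            hubbardGridSub L M β (2 * (2 * M))) X' (((t, y), σ), c)‖ ≤
      96 * 3960000 * (2 * Real.pi * (1 + 4 / klE0) * 4 + 12 * Real.pi ^ 2 * (1 + 4 / klE0) ^ 2 * 4 ^ 2 +
        144 * Real.pi ^ 3 * (1 + 4 / klE0) ^ 3 * 4 ^ 3) / klE0 := by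
  haveI : NeZero (2 * (2 * M)) := ⟨by have := NeZero.ne M; omega⟩
  exact sum_tnorm_mul_norm_gridSub_hubbardCovAboveCT_sectional_le (L := L) (M := M) (N := 2 * (2 * M)) (by omega) hβ
    (by norm_num [klE0]) (by norm_num) norm_iteratedDeriv_salmhoferCutoff_le_numeral (μ := μ) (K := 0) (D := 4) (by norm_num)
    (fun i hi _ p => EngineV8.norm_iteratedFDeriv_frameLevel_zero_le_pow μ hi p) X' t σ c

/-- The scale-`0` sectional constant is at most `2^74`. -/
theorem scaleZero_sectionalConst_le_two_pow :
    96 * 3960000 * (2 * Real.pi * (1 + 4 / klE0) * 4 + 12 * Real.pi ^ 2 * (1 + 4 / klE0) ^ 2 * 4 ^ 2 +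
        144 * Real.pi ^ 3 * (1 + 4 / klE0) ^ 3 * 4 ^ 3) / klE0 ≤ (2 : ℝ) ^ 74 := by
  have hπ := Real.pi_lt_four
  have hπ0 := Real.pi_pos
  have h2 : Real.pi ^ 2 ≤ 16 := by nlinarith
  have h3 : Real.pi ^ 3 ≤ 64 := by nlinarith
  rw [klE0]
  norm_num
  nlinarith [h2, h3]

/-- **`hsec` OF FILE C** (`abs_klLocalPart_flowFrame_zero_sub_le_of_gridData`) at scale `0`, with `Te := 2^74/(R+1)`: the fixed-time far
spatial sums of `G_L = S_Lᵀ C⁰_{>e₀} S_L` on the `2(2M)`-grid, for every `M`, `L`, `0 < β`, `μ`, `R`. -/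
theorem hsec_scaleZero {β : ℝ} (hβ : 0 < β) (μ : ℝ) (R : ℕ) (X' : GridLeg (GridPoint L (2 * (2 * M))))
    (t : Fin (2 * (2 * M))) (σ c : Fin 2) :
    ∑ y ∈ univ.filter (fun y : TorusSite 2 L => R < Torus.tnorm (X'.1.1.2 - y)),
        ‖((hubbardGridSub L M β (2 * (2 * M))).transpose * hubbardCovAboveCT L M β μ 0 0 klE0 *
            hubbardGridSub L M β (2 * (2 * M))) X' (((t, y), σ), c)‖ ≤ (2 : ℝ) ^ 74 / ((R : ℝ) + 1) := by
  have h := sum_filter_le_div_of_weight univ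
    (fun y : TorusSite 2 L => ‖((hubbardGridSub L M β (2 * (2 * M))).transpose * hubbardCovAboveCT L M β μ 0 0 klE0 *
      hubbardGridSub L M β (2 * (2 * M))) X' (((t, y), σ), c)‖)
    (fun y : TorusSite 2 L => Torus.tnorm (X'.1.1.2 - y)) (fun _ _ => norm_nonneg _) R
  refine h.trans ?_
  rw [div_eq_inv_mul _ ((R : ℝ) + 1)]
  exact mul_le_mul_of_nonneg_left
    ((sum_tnorm_mul_norm_scaleZero_sectional_le hβ μ X' t σ c).trans scaleZero_sectionalConst_le_two_pow) (by positivity)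

/-- **The `(1 + tnorm)`-weighted sectional row** (k3c5-p2's `sum_sectional_far_norm_le_of_sectionalMoment` currency `e₁`) at scale `0`:
given a sup-entry bound `s`, `Σ_y ‖G_L X′ (((t,y),σ),c)‖·(1 + tnorm(x′−y)) ≤ s + 2·2^74`. -/
theorem sectionalMoment_scaleZero_le_of_entry {β : ℝ} (hβ : 0 < β) (μ : ℝ) {s : ℝ}
    (hs : ∀ X Y, ‖((hubbardGridSub L M β (2 * (2 * M))).transpose * hubbardCovAboveCT L M β μ 0 0 klE0 *
      hubbardGridSub L M β (2 * (2 * M))) X Y‖ ≤ s)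
    (X' : GridLeg (GridPoint L (2 * (2 * M)))) (t : Fin (2 * (2 * M))) (σ c : Fin 2) :
    ∑ y : TorusSite 2 L, ‖((hubbardGridSub L M β (2 * (2 * M))).transpose * hubbardCovAboveCT L M β μ 0 0 klE0 *
        hubbardGridSub L M β (2 * (2 * M))) X' (((t, y), σ), c)‖ * (1 + (Torus.tnorm (X'.1.1.2 - y) : ℝ)) ≤ s + 2 * (2 : ℝ) ^ 74 := by
  classical
  have hmom := (sum_tnorm_mul_norm_scaleZero_sectional_le (L := L) (M := M) hβ μ X' t σ c).trans scaleZero_sectionalConst_le_two_pow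
  set G := (hubbardGridSub L M β (2 * (2 * M))).transpose * hubbardCovAboveCT L M β μ 0 0 klE0 * hubbardGridSub L M β (2 * (2 * M))
    with hG
  -- split off the diagonal term `y = x′` (weight `1`); off the diagonal `1 ≤ tnorm`
  have hpt : ∀ y : TorusSite 2 L, ‖G X' (((t, y), σ), c)‖ * (1 + (Torus.tnorm (X'.1.1.2 - y) : ℝ)) ≤
      (if X'.1.1.2 = y then ‖G X' (((t, y), σ), c)‖ else 0) + 2 * ((Torus.tnorm (X'.1.1.2 - y) : ℝ) * ‖G X' (((t, y), σ), c)‖) := by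
    intro y
    by_cases hy : X'.1.1.2 = y
    · rw [if_pos hy, hy, sub_self, tnorm_zero']
      simp
    · rw [if_neg hy, zero_add]
      have h1 : (1 : ℝ) ≤ Torus.tnorm (X'.1.1.2 - y) := by
        have hne : X'.1.1.2 - y ≠ 0 := sub_ne_zero.2 hy
        have hpos : 0 < Torus.tnorm (X'.1.1.2 - y) := by
          by_contra h0
          push Not at h0
          exact hne (eq_zero_of_tnorm_eq_zero (Nat.le_zero.1 h0))
        exact_mod_cast hpos
      nlinarith [norm_nonneg (G X' (((t, y), σ), c))]
  refine (sum_le_sum fun y _ => hpt y).trans ?_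
  rw [sum_add_distrib, ← mul_sum]
  simp only [Finset.sum_ite_eq, Finset.mem_univ, if_true]
  exact add_le_add (hs _ _) (by linarith)

/-- **`hs` OF FILE C** at scale `0`: the sup entry `‖G_L X Y‖ ≤ 2(7+6047)` of the bare-frame grid covariance for an admissible bare frame,
`klBetaMin ≤ β ≤ L` (k3c5-p1's `isGramBoundedR_scaleZero_of_frameOK_sharp` + antisymmetry). -/
theorem hs_scaleZero {R : RenConsts} {U : ℝ} {Nfr : ℕ} {μ : ℝ} (hK : FrameOK R U Nfr μ 0) {β : ℝ} (hβ : klBetaMin ≤ β)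
    (hβL : β ≤ L) (X Y : GridLeg (GridPoint L (2 * (2 * M)))) :
    ‖((hubbardGridSub L M β (2 * (2 * M))).transpose * hubbardCovAboveCT L M β μ 0 0 klE0 *
        hubbardGridSub L M β (2 * (2 * M))) X Y‖ ≤ 2 * (7 + 6047) := by
  haveI : NeZero (2 * (2 * M)) := ⟨by have := NeZero.ne M; omega⟩
  have h := norm_gridSub_hubbardCovAboveCT_apply_le_of_isGramBoundedR (L := L) (M := M) (N := 2 * (2 * M)) μ 0 klE0
    (isGramBoundedR_scaleZero_of_frameOK_sharp (L := L) hK hβ hβL) X Y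
  rwa [Real.sq_sqrt (by norm_num)] at h

/-- **`e₁` at scale `0`** (the `(1+tnorm)`-weighted sectional row, k3c5-p2's DataKit currency): `≤ 2(7+6047) + 2·2^74` for an admissible
bare frame, `klBetaMin ≤ β ≤ L`. -/
theorem sectionalMoment_scaleZero_le {R : RenConsts} {U : ℝ} {Nfr : ℕ} {μ : ℝ} (hK : FrameOK R U Nfr μ 0) {β : ℝ}
    (hβ : klBetaMin ≤ β) (hβL : β ≤ L) (X' : GridLeg (GridPoint L (2 * (2 * M)))) (t : Fin (2 * (2 * M))) (σ c : Fin 2) :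
    ∑ y : TorusSite 2 L, ‖((hubbardGridSub L M β (2 * (2 * M))).transpose * hubbardCovAboveCT L M β μ 0 0 klE0 *
        hubbardGridSub L M β (2 * (2 * M))) X' (((t, y), σ), c)‖ * (1 + (Torus.tnorm (X'.1.1.2 - y) : ℝ)) ≤
      2 * (7 + 6047) + 2 * (2 : ℝ) ^ 74 :=
  sectionalMoment_scaleZero_le_of_entry (lt_of_lt_of_le (by norm_num [klBetaMin]) hβ) μ (hs_scaleZero hK hβ hβL) X' t σ c

end ScaleZero

end Summit.HubbardSuperconductivity.HubbardSuperconductivity.Theorems.TwoVolumeDefect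

end
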